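import Summits.Ventures.QEC.CircuitDistance.PortColumns
import HarnessLib

/-!
# P3-PORT (B): the BRIDGE — T2 (undetectable ⇒ residual in `ker H^Z × ker H^X`), `LogicalError` per sector, the MERGE lemma
# (one fault per operation: `faultCount` = cardinality) (cell `qec`, experiment CDX, seat qec-cdx-type-1)

* `flipZ_zero`/`flipX_zero` and **`residual_syndrome_zero`** (T2): an undetectable fault set leaves a residual data error
  with zero true syndrome, `H^Z·dataX = 0 ∧ H^X·dataZ = 0` (telescoping of the difference detectors from the ideal initial
  code state to the ideal final read-out);
* `logicalError_iff`: `LogicalError ↔ dataX ∉ rowSpace H^X ∨ dataZ ∉ rowSpace H^Z`;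
* `Fault.merge`, `run1_merge` (linearity in the Pauli at one operation), `Reduced`, **`exists_reduced`** (every fault set is
  matched, column for column, by a reduced one on a subset of its operations with `card ≤ faultCount`) and
  `hasAt_iff_reduced`;
Generic in `S`; nothing here asserts a value of `d_circ`.
-/

namespace Summit.Ventures.QEC.CircuitDistance

open Literature.InformationTheory.QuantumCodes

variable {ℓ m : ℕ} [NeZero ℓ] [NeZero m]

/-! ## T2: telescoping -/

/-- No fault flips a `Z`-check outcome of "cycle 0" (there is none). -/
theorem run1_mZ_zero (S : SMCode ℓ m) (Nc : ℕ) (f : Fault ℓ m) (j : BB.Mono ℓ m) : (run1 S Nc f).mZ 0 j = false := by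
  by_cases h : f.ev ∈ allEvents Nc
  · rw [mem_allEvents_iff, Fault.ev_cyc] at h
    rw [run1_mZ S Nc f h.1 h.2, if_neg (by omega)]
    exact shape_mZ_of_ne S f (by omega) j
  · rw [run1_of_not_mem S Nc f h]; rfl

/-- No fault flips an `X`-check outcome of "cycle 0". -/
theorem run1_mX_zero (S : SMCode ℓ m) (Nc : ℕ) (f : Fault ℓ m) (i : BB.Mono ℓ m) : (run1 S Nc f).mX 0 i = false := by
  by_cases h : f.ev ∈ allEvents Nc
  · rw [mem_allEvents_iff, Fault.ev_cyc] at h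
    rw [run1_mX S Nc f h.1 h.2, if_neg (by omega)]
    exact shape_mX_of_ne S f (by omega) i
  · rw [run1_of_not_mem S Nc f h]; rfl

/-- The telescoping base: `flipZ … 0 = false`. -/
theorem flipZ_zero (S : SMCode ℓ m) (Nc : ℕ) (F : Finset (Fault ℓ m)) (j : BB.Mono ℓ m) : flipZ S Nc F 0 j = false := by
  unfold flipZ; rw [bsum_congr (fun f _ => run1_mZ_zero S Nc f j)]; exact bsum_false F

/-- The telescoping base: `flipX … 0 = false`. -/
theorem flipX_zero (S : SMCode ℓ m) (Nc : ℕ) (F : Finset (Fault ℓ m)) (i : BB.Mono ℓ m) : flipX S Nc F 0 i = false := by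
  unfold flipX; rw [bsum_congr (fun f _ => run1_mX_zero S Nc f i)]; exact bsum_false F

omit [NeZero ℓ] [NeZero m] in
/-- In `ZMod 2`, not `1` means `0`. -/
theorem ZMod2_eq_zero_of_ne_one {x : ZMod 2} (h : x ≠ 1) : x = 0 := by
  revert x; decide

/-- **T2 (residual syndrome).** An undetectable fault set leaves a residual data error with ZERO true syndrome. -/
theorem residual_syndrome_zero (S : SMCode ℓ m) (Nc : ℕ) (F : Finset (Fault ℓ m)) (hU : Undetectable S Nc F) :
    S.toCode.HZ.mulVec (dataX S Nc F) = 0 ∧ S.toCode.HX.mulVec (dataZ S Nc F) = 0 := by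
  obtain ⟨-, hdet⟩ := hU
  -- telescoping: all outcome flips vanish
  have hZ : ∀ t, t ≤ Nc → ∀ j, flipZ S Nc F t j = false := by
    intro t
    induction t with
    | zero => intro _ j; exact flipZ_zero S Nc F j
    | succ t ih =>
      intro ht j
      have h := (hdet (t + 1) j).2
      unfold detZ at h
      rw [if_neg (by omega), if_pos ht, Nat.add_sub_cancel, ih (by omega) j, Bool.xor_false] at h
      exact h
  have hX : ∀ t, t ≤ Nc → ∀ i, flipX S Nc F t i = false := by
    intro t
    induction t with
    | zero => intro _ i; exact flipX_zero S Nc F i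
    | succ t ih =>
      intro ht i
      have h := (hdet (t + 1) i).1
      unfold detX at h
      rw [if_neg (by omega), if_pos ht, Nat.add_sub_cancel, ih (by omega) i, Bool.xor_false] at h
      exact h
  constructor
  · funext j
    have h := (hdet (Nc + 1) j).2
    unfold detZ at h
    rw [if_neg (by omega), if_neg (by omega), if_pos rfl, hZ Nc le_rfl j, Bool.xor_false, decide_eq_false_iff_not] at h
    exact ZMod2_eq_zero_of_ne_one h
  · funext i
    have h := (hdet (Nc + 1) i).1
    unfold detX at h
    rw [if_neg (by omega), if_neg (by omega), if_pos rfl, hX Nc le_rfl i, Bool.xor_false, decide_eq_false_iff_not] at h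
    exact ZMod2_eq_zero_of_ne_one h

/-- `LogicalError` unfolded per sector: the residual `X`-part is not an `X`-stabiliser or the residual `Z`-part is not a
`Z`-stabiliser (`css.rowSpX = rowSpace H^X`, `css.swap.rowSpX = rowSpace H^Z`). -/
theorem logicalError_iff (S : SMCode ℓ m) (Nc : ℕ) (F : Finset (Fault ℓ m)) :
    LogicalError S Nc F ↔ dataX S Nc F ∉ rowSpace S.toCode.HX ∨ dataZ S Nc F ∉ rowSpace S.toCode.HZ := by
  unfold LogicalError; rw [not_and_or]; exact Iff.rfl

/-! ## Merging faults on one operation -/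

omit [NeZero ℓ] [NeZero m] in
/-- The product of two faults on the same operation (CNOT: product of the two-qubit Paulis; idle: product of the Paulis;
otherwise the first fault — two distinct faults never share an `Init`/`Meas` location). -/
def Fault.merge : Fault ℓ m → Fault ℓ m → Fault ℓ m
  | .cnot c lay i pc pt, .cnot _ _ _ pc' pt' => .cnot c lay i (P1.mul pc pc') (P1.mul pt pt')
  | .idle c s i p, .idle _ _ _ p' => .idle c s i (P1.mul p p')
  | f, _ => f

omit [NeZero ℓ] [NeZero m] in
/-- The operation determines the event. -/
theorem Fault.ev_eq_of_loc_eq {f g : Fault ℓ m} (h : f.loc = g.loc) : f.ev = g.ev := by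
  cases f <;> cases g <;> simp_all [Fault.loc, Fault.ev]

omit [NeZero ℓ] [NeZero m] in
/-- The merged fault sits on the same operation. -/
theorem Fault.loc_merge {f g : Fault ℓ m} (h : f.loc = g.loc) : (f.merge g).loc = f.loc := by
  cases f <;> cases g <;> simp_all [Fault.loc, Fault.merge]

omit [NeZero ℓ] [NeZero m] in
/-- Register of a CNOT layer's control differs from its target's. -/
theorem Layer.ctrl_ne_tgt' (lay : Layer) : lay.ctrl ≠ lay.tgt := by cases lay <;> decide

/-- The merged fault injects the sum of the injected vectors (distinct faults on one operation). -/
theorem delta_merge (S : SMCode ℓ m) {f g : Fault ℓ m} (h : f.loc = g.loc) (hne : f ≠ g) :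
    delta S (f.merge g) = (delta S f).add (delta S g) := by
  cases f with
  | cnot c lay i pc pt =>
    cases g with
    | cnot c' lay' i' pc' pt' =>
      simp only [Fault.loc, Loc.cnot.injEq] at h
      obtain ⟨rfl, rfl, rfl⟩ := h
      have hq : ((lay.ctrl, i) : Qubit ℓ m) ≠ (lay.tgt, i + lay.mon S) := fun e => Layer.ctrl_ne_tgt' lay (Prod.mk.inj e).1
      refine State.ext' (funext fun q => ?_) rfl rfl
      simp only [delta, inject, Fault.merge, State.add, State.init, Frame.mulAt, P1.mul_def]
      by_cases h1 : q = (lay.tgt, i + lay.mon S)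
      · subst h1; simp [hq.symm]
      · by_cases h2 : q = (lay.ctrl, i)
        · subst h2; simp [hq]
        · simp [h1, h2]
    | _ => simp [Fault.loc] at h
  | idle c s i p =>
    cases g with
    | idle c' s' i' p' =>
      simp only [Fault.loc, Loc.idle.injEq] at h
      obtain ⟨rfl, rfl, rfl⟩ := h
      refine State.ext' (funext fun q => ?_) rfl rfl
      simp only [delta, inject, Fault.merge, State.add, State.init, Frame.mulAt, P1.mul_def]
      by_cases h2 : q = (s.reg, i)
      · subst h2; simp
      · simp [h2]
    | _ => simp [Fault.loc] at h
  | initX c i => cases g <;> simp_all [Fault.loc]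
  | initZ c i => cases g <;> simp_all [Fault.loc]
  | measX c i => cases g <;> simp_all [Fault.loc]
  | measZ c i => cases g <;> simp_all [Fault.loc]

/-- **Linearity in the Pauli at one operation**: the effect of the merged fault is the sum of the effects. -/
theorem run1_merge (S : SMCode ℓ m) (Nc : ℕ) {f g : Fault ℓ m} (h : f.loc = g.loc) (hne : f ≠ g) :
    run1 S Nc (f.merge g) = (run1 S Nc f).add (run1 S Nc g) := by
  unfold run1
  have hev : (f.merge g).ev = f.ev := Fault.ev_eq_of_loc_eq (Fault.loc_merge h)
  have hev' : g.ev = f.ev := (Fault.ev_eq_of_loc_eq h).symm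
  exact simulate_init_add S hev.symm (hev'.trans hev.symm) (delta_merge S h hne) (allEvents Nc)

omit [NeZero ℓ] [NeZero m] in
/-- In `ZMod 2`, `decide (x + y = 1)` is the XOR. -/
theorem decide_add_eq_one (x y : ZMod 2) : decide (x + y = 1) = xor (decide (x = 1)) (decide (y = 1)) := by
  revert x y; decide

/-- Columns of the merged fault: `Z`-detectors add. -/
theorem detZ_merge (S : SMCode ℓ m) (Nc : ℕ) {f g : Fault ℓ m} (h : f.loc = g.loc) (hne : f ≠ g) (t : ℕ) (j : BB.Mono ℓ m) :
    detZ S Nc {f.merge g} t j = xor (detZ S Nc {f} t j) (detZ S Nc {g} t j) := by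
  have hd : dataX S Nc {f.merge g} = dataX S Nc {f} + dataX S Nc {g} := by
    rw [dataX_singleton_run1, dataX_singleton_run1, dataX_singleton_run1, run1_merge S Nc h hne, ← toZ2_xor]; rfl
  unfold detZ
  simp only [flipZ_singleton, run1_merge S Nc h hne, hd, Matrix.mulVec_add, Pi.add_apply, decide_add_eq_one]
  split_ifs
  · rfl
  · show xor (xor _ _) (xor _ _) = _
    generalize (run1 S Nc f).mZ t j = a; generalize (run1 S Nc g).mZ t j = b
    generalize (run1 S Nc f).mZ (t - 1) j = c; generalize (run1 S Nc g).mZ (t - 1) j = d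
    cases a <;> cases b <;> cases c <;> cases d <;> rfl
  · show xor (xor _ _) (xor _ _) = _
    generalize decide ((S.toCode.HZ.mulVec (dataX S Nc {f})) j = 1) = a
    generalize decide ((S.toCode.HZ.mulVec (dataX S Nc {g})) j = 1) = b
    generalize (run1 S Nc f).mZ Nc j = c; generalize (run1 S Nc g).mZ Nc j = d
    cases a <;> cases b <;> cases c <;> cases d <;> rfl
  · rfl

/-- Columns of the merged fault: `X`-detectors add. -/
theorem detX_merge (S : SMCode ℓ m) (Nc : ℕ) {f g : Fault ℓ m} (h : f.loc = g.loc) (hne : f ≠ g) (t : ℕ) (i : BB.Mono ℓ m) :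
    detX S Nc {f.merge g} t i = xor (detX S Nc {f} t i) (detX S Nc {g} t i) := by
  have hd : dataZ S Nc {f.merge g} = dataZ S Nc {f} + dataZ S Nc {g} := by
    rw [dataZ_singleton_run1, dataZ_singleton_run1, dataZ_singleton_run1, run1_merge S Nc h hne, ← toZ2_xor]; rfl
  unfold detX
  simp only [flipX_singleton, run1_merge S Nc h hne, hd, Matrix.mulVec_add, Pi.add_apply, decide_add_eq_one]
  split_ifs
  · rfl
  · show xor (xor _ _) (xor _ _) = _
    generalize (run1 S Nc f).mX t i = a; generalize (run1 S Nc g).mX t i = b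
    generalize (run1 S Nc f).mX (t - 1) i = c; generalize (run1 S Nc g).mX (t - 1) i = d
    cases a <;> cases b <;> cases c <;> cases d <;> rfl
  · show xor (xor _ _) (xor _ _) = _
    generalize decide ((S.toCode.HX.mulVec (dataZ S Nc {f})) i = 1) = a
    generalize decide ((S.toCode.HX.mulVec (dataZ S Nc {g})) i = 1) = b
    generalize (run1 S Nc f).mX Nc i = c; generalize (run1 S Nc g).mX Nc i = d
    cases a <;> cases b <;> cases c <;> cases d <;> rfl
  · rfl

/-- Residual `X`-errors of the merged fault add. -/
theorem dataX_merge (S : SMCode ℓ m) (Nc : ℕ) {f g : Fault ℓ m} (h : f.loc = g.loc) (hne : f ≠ g) :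
    dataX S Nc {f.merge g} = dataX S Nc {f} + dataX S Nc {g} := by
  rw [dataX_singleton_run1, dataX_singleton_run1, dataX_singleton_run1, run1_merge S Nc h hne, ← toZ2_xor]; rfl

/-- Residual `Z`-errors of the merged fault add. -/
theorem dataZ_merge (S : SMCode ℓ m) (Nc : ℕ) {f g : Fault ℓ m} (h : f.loc = g.loc) (hne : f ≠ g) :
    dataZ S Nc {f.merge g} = dataZ S Nc {f} + dataZ S Nc {g} := by
  rw [dataZ_singleton_run1, dataZ_singleton_run1, dataZ_singleton_run1, run1_merge S Nc h hne, ← toZ2_xor]; rfl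

/-! ## Reduction to one fault per operation -/

omit [NeZero ℓ] [NeZero m] in
/-- A fault set is REDUCED if no two of its members sit on the same operation. -/
def Reduced (F : Finset (Fault ℓ m)) : Prop := Set.InjOn Fault.loc (F : Set (Fault ℓ m))

omit [NeZero ℓ] [NeZero m] in
/-- For a reduced set the number of faulty operations is the number of faults. -/
theorem faultCount_eq_card_of_reduced {F : Finset (Fault ℓ m)} (h : Reduced F) : faultCount F = F.card :=
  Finset.card_image_of_injOn h

/-- Two fault sets have the SAME COLUMNS in the `Nc`-circuit: all detectors and both residuals agree. -/
def SameCols (S : SMCode ℓ m) (Nc : ℕ) (F F' : Finset (Fault ℓ m)) : Prop :=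
  (∀ t i, detX S Nc F' t i = detX S Nc F t i) ∧ (∀ t j, detZ S Nc F' t j = detZ S Nc F t j) ∧
    dataX S Nc F' = dataX S Nc F ∧ dataZ S Nc F' = dataZ S Nc F

/-- `SameCols` is reflexive. -/
theorem SameCols.refl (S : SMCode ℓ m) (Nc : ℕ) (F : Finset (Fault ℓ m)) : SameCols S Nc F F :=
  ⟨fun _ _ => rfl, fun _ _ => rfl, rfl, rfl⟩

/-- `SameCols` is transitive. -/
theorem SameCols.trans {S : SMCode ℓ m} {Nc : ℕ} {F F' F'' : Finset (Fault ℓ m)} (h : SameCols S Nc F F')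
    (h' : SameCols S Nc F' F'') : SameCols S Nc F F'' :=
  ⟨fun t i => (h'.1 t i).trans (h.1 t i), fun t j => (h'.2.1 t j).trans (h.2.1 t j), h'.2.2.1.trans h.2.2.1,
    h'.2.2.2.trans h.2.2.2⟩

/-- One MERGE STEP: replace two distinct faults `f ≠ g` on one operation by their product (toggled). -/
theorem merge_step (S : SMCode ℓ m) (Nc : ℕ) (F : Finset (Fault ℓ m)) {f g : Fault ℓ m} (hf : f ∈ F) (hg : g ∈ F)
    (hne : f ≠ g) (h : f.loc = g.loc) :
    ∃ F' : Finset (Fault ℓ m), F'.card < F.card ∧ F'.image Fault.loc ⊆ F.image Fault.loc ∧ SameCols S Nc F F' := by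
  classical
  set R := (F.erase f).erase g with hR
  have hgR : g ∈ F.erase f := Finset.mem_erase.2 ⟨hne.symm, hg⟩
  have hRcard : R.card + 2 = F.card := by
    rw [hR, Finset.card_erase_of_mem hgR, Finset.card_erase_of_mem hf]
    have := Finset.card_pos.2 ⟨f, hf⟩
    have : 2 ≤ F.card := by
      have : ({f, g} : Finset (Fault ℓ m)) ⊆ F := by
        intro x hx; rcases Finset.mem_insert.1 hx with rfl | hx
        · exact hf
        · rw [Finset.mem_singleton.1 hx]; exact hg
      have h2 := Finset.card_le_card this
      rw [Finset.card_pair hne] at h2; exact h2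
    omega
  have hFR : F = insert f (insert g R) := by
    rw [hR, Finset.insert_erase hgR, Finset.insert_erase hf]
  have hfR : f ∉ insert g R := by
    rw [Finset.mem_insert, not_or]; exact ⟨hne, fun h' => by rw [hR] at h'; exact (Finset.mem_erase.1 (Finset.mem_erase.1 h').2).1 rfl⟩
  have hgR' : g ∉ R := fun h' => (Finset.mem_erase.1 h').1 rfl
  -- parity bookkeeping for Bool- and 𝔽₂-valued columns
  have key_b : ∀ (col : Fault ℓ m → Bool), col (f.merge g) = xor (col f) (col g) →
      ∀ F' : Finset (Fault ℓ m), (F' = if f.merge g ∈ R then R.erase (f.merge g) else insert (f.merge g) R) →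
      bsum F' col = bsum F col := by
    intro col hcol F' hF'
    rw [hFR, bsum_insert hfR, bsum_insert hgR']
    split_ifs at hF' with hm
    · rw [hF']
      have := bsum_insert (Finset.notMem_erase (f.merge g) R) col
      rw [Finset.insert_erase hm, hcol] at this
      rw [this]; cases col f <;> cases col g <;> cases bsum (R.erase (f.merge g)) col <;> rfl
    · rw [hF', bsum_insert hm, hcol, Bool.xor_assoc]
  have key_v : ∀ (col : Fault ℓ m → (BB.Mono ℓ m ⊕ BB.Mono ℓ m → ZMod 2)), col (f.merge g) = col f + col g →
      ∀ F' : Finset (Fault ℓ m), (F' = if f.merge g ∈ R then R.erase (f.merge g) else insert (f.merge g) R) →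
      ∑ x ∈ F', col x = ∑ x ∈ F, col x := by
    intro col hcol F' hF'
    rw [hFR, Finset.sum_insert hfR, Finset.sum_insert hgR']
    split_ifs at hF' with hm
    · rw [hF']
      have := Finset.sum_insert (Finset.notMem_erase (f.merge g) R) (f := col)
      rw [Finset.insert_erase hm, hcol] at this
      rw [this]
      have h2 : col f + col g + (col f + col g + ∑ x ∈ R.erase (f.merge g), col x) = ∑ x ∈ R.erase (f.merge g), col x := by
        funext q; simp only [Pi.add_apply]
        have : ∀ a b c : ZMod 2, a + b + (a + b + c) = c := by decide
        exact this _ _ _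
      rw [← add_assoc, h2]
    · rw [hF', Finset.sum_insert hm, hcol, add_assoc]
  refine ⟨if f.merge g ∈ R then R.erase (f.merge g) else insert (f.merge g) R, ?_, ?_, ?_⟩
  · split_ifs with hm
    · have := Finset.card_erase_of_mem hm; omega
    · rw [Finset.card_insert_of_notMem hm]; omega
  · intro x hx
    rw [Finset.mem_image] at hx ⊢
    obtain ⟨y, hy, rfl⟩ := hx
    have hyR : y ∈ R ∨ y = f.merge g := by
      split_ifs at hy with hm
      · exact Or.inl (Finset.mem_of_mem_erase hy)
      · rcases Finset.mem_insert.1 hy with rfl | hy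
        · exact Or.inr rfl
        · exact Or.inl hy
    rcases hyR with hyR | rfl
    · exact ⟨y, Finset.mem_of_mem_erase (Finset.mem_of_mem_erase hyR), rfl⟩
    · exact ⟨f, hf, (Fault.loc_merge h).symm⟩
  · refine ⟨fun t i => ?_, fun t j => ?_, ?_, ?_⟩
    · rw [detX_eq_bsum, detX_eq_bsum S Nc F]
      exact key_b (fun x => detX S Nc {x} t i) (detX_merge S Nc h hne t i) _ rfl
    · rw [detZ_eq_bsum, detZ_eq_bsum S Nc F]
      exact key_b (fun x => detZ S Nc {x} t j) (detZ_merge S Nc h hne t j) _ rfl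
    · rw [dataX_eq_sum, dataX_eq_sum S Nc F]
      exact key_v (fun x => dataX S Nc {x}) (dataX_merge S Nc h hne) _ rfl
    · rw [dataZ_eq_sum, dataZ_eq_sum S Nc F]
      exact key_v (fun x => dataZ S Nc {x}) (dataZ_merge S Nc h hne) _ rfl

/-- **MERGE LEMMA.** Every fault set is matched, column for column, by a REDUCED set on a subset of its operations with
`card ≤ faultCount`. -/
theorem exists_reduced (S : SMCode ℓ m) (Nc : ℕ) (F : Finset (Fault ℓ m)) :
    ∃ F' : Finset (Fault ℓ m), Reduced F' ∧ F'.card ≤ faultCount F ∧ F'.image Fault.loc ⊆ F.image Fault.loc ∧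
      SameCols S Nc F F' := by
  classical
  induction hn : F.card using Nat.strong_induction_on generalizing F with
  | _ n ih =>
    by_cases hR : Reduced F
    · exact ⟨F, hR, (faultCount_eq_card_of_reduced hR).ge, subset_rfl, SameCols.refl S Nc F⟩
    · -- two distinct faults on one operation
      unfold Reduced Set.InjOn at hR
      push Not at hR
      obtain ⟨f, hf, g, hg, hloc, hne⟩ := hR
      obtain ⟨F₁, hcard, himg, hcols⟩ := merge_step S Nc F (Finset.mem_coe.1 hf) (Finset.mem_coe.1 hg) hne hloc
      obtain ⟨F', hR', hcard', himg', hcols'⟩ := ih F₁.card (by omega) F₁ rfl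
      refine ⟨F', hR', ?_, himg'.trans himg, hcols.trans hcols'⟩
      calc F'.card ≤ faultCount F₁ := hcard'
        _ ≤ faultCount F := Finset.card_le_card himg

/-- Hence the weight predicate may be read with cardinality in place of `faultCount`. -/
theorem hasAt_iff_reduced (S : SMCode ℓ m) (Nc w : ℕ) :
    HasLogicalFaultOfWeightAtMostAt S Nc w ↔
      ∃ F : Finset (Fault ℓ m), Reduced F ∧ Undetectable S Nc F ∧ LogicalError S Nc F ∧ F.card ≤ w := by
  constructor
  · rintro ⟨F, hU, hL, hw⟩
    obtain ⟨F', hR, hcard, himg, hX, hZ, hdX, hdZ⟩ := exists_reduced S Nc F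
    refine ⟨F', hR, ⟨?_, fun t i => ⟨?_, ?_⟩⟩, ?_, hcard.trans hw⟩
    · intro f' hf'
      have : f'.loc ∈ F.image Fault.loc := himg (Finset.mem_image_of_mem _ hf')
      obtain ⟨f, hf, hfl⟩ := Finset.mem_image.1 this
      rw [← Fault.ev_eq_of_loc_eq hfl]; exact hU.1 f hf
    · rw [hX]; exact (hU.2 t i).1
    · rw [hZ]; exact (hU.2 t i).2
    · unfold LogicalError at hL ⊢; rw [hdX, hdZ]; exact hL
  · rintro ⟨F, hR, hU, hL, hw⟩
    exact ⟨F, hU, hL, (faultCount_eq_card_of_reduced hR).le.trans hw⟩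

end Summit.Ventures.QEC.CircuitDistance
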